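import Summits.QuantumFields.YangMills.Theorems.BalabanUVNodesN15FullPropagatorCov2156N15At

/-!
# Route «BalabanUVNodes», cluster K4 «SpineRates» — node N15 = NE2, -a lane, part 82 (programme S, file S-A): THE SIZED (GUARD-LIVE) EDITION OF THE
# GENUINE `U ≡ 1` FAMILY — Bałaban's [B9] size parameter `M` as a FREE index, cofinal in `gf.M` AND `gc.k` — with the guard-free content certificates
# and `N15At` (all three NE2 conjuncts BY NAME) OUTRIGHT on it

Cell `pub-ymgap`, seat `pub-ymgap-dag-n15-a` (-a KNIT-BY-NAME seat of node N15, «vector layer by the scalar template»; HUMAN RULING D-0062; chair R424 venue),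
generation 18, part 82.  `bears_on: R4∕N15 · K3⁷ SpineGivenEndpointR13SepCoPH (stmt-QuantumFields-20544)`.  Filed `--supports stmt-QuantumFields-20544 --as helper` —
COUNT-NEUTRAL.  Data `def`s (an index structure, two sized geometries, a pairing, a paired instance, three transported kernel families) + theorems; 0 `sorry`.
Imports part 76 `…N15FullPropagatorCov2156N15At` ONLY (through it: parts 52∕54∕55∕59∕60∕71∕72∕73, dag-n15-c G1∕G3, `T4Cov2156Rate`); nothing in the tree is modified or
re-declared.

WHY (the located door of g18).  Width seat dag-n15-w2's kernel fact (pub-ymgap INBOX l.24210, file `…N15PairedFamilyGuard`, 2026-08-27): on every family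
`tgInstance d hL ∘ f` of part 55 the fine geometry has `gf.M = 1` (`rfl`), hence (i) the family FAILS the K3⁷ v2 guard `PairedFamilyGuard.Live` (cofinality in `gf.M`
and `gc.k`), and (ii) `T4EtaRate.NE2PlusOperator` (:250) ∕ `NE2PlusSite` (:257) hold there FOR ARBITRARY KERNELS with `M₅ := 2` — the BY-NAME readouts of the -a lane on
`tgInstance` (part 72 `ne2PlusOperator_fullG`, dag-n15-c G1 `ne2PlusSite_genuineSite`, parts 73∕76 `n15At_fullG_genuine` ∕ `n15At_fullG_tgCov`, V-D `n15At_fullG_C2_bgEx`)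
are PROVED CONTENTFULLY but are VACUOUS-ABLE AS STATEMENTS.  The repair is the one this seat applied in g5 to the vector single-scale piece (part 25 `VecIndexS`, p448474;
referee ref-B READ-335 A2 option (ii)) and never carried to the full-propagator family: realise Bałaban's size parameter `M` ([B9] p.396: the large cubes of the
regularity condition (3.35) have side `O(1)·M`; «for M ≥ M₁» in Thm 3.1 p.397) as a FREE index copied into both geometries' `M` field.  At `U ≡ 1` nothing depends on `M`
(the «+» blocks are inert on the one-point background carrier), so every estimate is uniform in it, the family becomes COFINAL in `gf.M` (and it already is in `gc.k`:
`k ≥ 1` free), and the by-name predicates SAY their content — §4 proves them EQUIVALENT to the guard-free statements (`…_sized_iff`).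

WHAT.
* §1 `TGIndexS` = part 55's `TGIndex` (`m_T`, `k ≥ 1`, `m`) with `m_T ≥ 1` (the L-divisible tori of part 76's `TGIndexL`, where (2.156) exists) and a FREE size `Msz ≥ 1`;
  `TGIndexS.toL`, `TGIndexL.withSize`, `tgIndexS_nonempty`, ★ `tgIndexS_cofinal` (`∀ M₅ k₀, ∃ j, M₅ ≤ j.Msz ∧ k₀ ≤ j.k` — the shape of w2's `Live.cofinal`).
* §2 the SIZED CARRIERS: `tgGeoCS`∕`tgGeoFS` (`{ tgGeoC∕tgGeoF … with M := j.Msz }`), `tgPairingS` (part 55's `tgPairing` field by field, `M_eq := rfl`), `tgInstanceS`; the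
  three kernel families of parts 72 ∕ G1 ∕ 76 TRANSPORTED VERBATIM (`tgFamilyS b ν μ` = `tgFamily b (tgT1 b ν) (tgT2 b μ)`, `genuineSiteStepS a_S`, `tgCovStepS α β`);
  `tgInstanceS_gf_M`∕`_gc_M`∕`_gc_k` (`rfl`), `reg_one_tgInstanceS`; the three `…S_iff` lemmas (`Iff.rfl`: the size field enters no inequality).
* §3 ★ `etaRateIneq342_fullG_family` — THE GUARD-FREE OPERATOR-LAYER CONTENT of parts 52∕54∕59∕71, `∃ B δ₀ γ₀ > 0 ∀ i : TGIndex, EtaRateIneq342 (tgFamily d hL b (tgT1 b ν)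
  (tgT2 b μ) i) B δ₀ γ₀ ()` — re-assembled OUTSIDE the by-name `∃ M₅` (parts 55∕60∕72 only ever stated it inside `NE2ZeroOperator`, where the idle guard hides it).
* §4 ★★ `ne2ZeroOperator_fullG_sized`, ★★ `ne2PlusOperator_fullG_sized` + `ne2PlusOperator_fullG_sized_iff` (BY NAME ⟺ guard-free content on every L-divisible torus:
  (⇒) read at size `max M₅ 1` with `α₀ := a₀ ∕ max M₅ 1`; (⇐) `M₅ = a₀ = 1`), ★★ `ne2PlusSite_genuineSite_sized` + `ne2PlusSite_genuineSite_sized_iff`, ★★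
  `ne2PlusUnit_tgCov_sized` + `ne2PlusUnit_tgCov_sized_iff` (the unit layer has no `M₅`; its guard `M·α₀ ≤ a₀` is read in the honest direction).
* §5 ★★★ **`n15At_fullG_sized`** — `N15At ⟨TGIndexS, c₃₅, p, tgInstanceS, tgFamilyS b ν μ, genuineSiteStepS a_S, tgCovStepS α β, ⊤, dist⟩` OUTRIGHT for `d ≥ 1`, odd `L ≥ 3`,
  `b, a_S > 0`, every `ν μ α β c₃₅ p`, on a family COFINAL in `gf.M` and `gc.k` (w2's `Live` certificate and the `NE2Objects₁₁` literal ∕ keyed ∕ CoPH faces are the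
  companion files S-B∕S-C).

HONEST FRAMING.  Count-neutral kernel bookkeeping + ONE re-assembly of LANDED estimates (parts 52∕54∕59∕71 through `etaRateIneq342_tg`); no new estimate.  WHAT THE FAMILY IS:
Bałaban's OWN `U ≡ 1` (A = 0) linear objects — [B5] (1.69)–(1.71) `(Δ′_b⁻¹, Δ_b⁻¹)` through all four (3.42) entries, [B4-I]∕[B5] `(Q′G′²Q′*)⁻¹` at King's couplings, [B6]
(2.156) `C^{(k)}_Λ` — on the L-divisible tori of record `M_μ = 2L^{m_T}`, `m_T ≥ 1`, `n = L^k`, `n′ = L^m·L^k`, NOW indexed ALSO by the size `M ≥ 1`; one-point background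
carrier, so (3.35)∕(3.36) are VOID and the «+» blocks inert (NE2⁰ content inside NE2⁺'s type) — EXCEPT the size guard, which is LIVE: the by-name predicates are no longer
satisfiable by an idle guard (§4 `…_iff`).  Rates `(L^k)^{−min(¼, 1∕16, 1∕(8(d+1)))}`, `L^{−k∕4}`, `L^{−k}` (sup-block-currency artefacts except the last).  WHAT IT IS NOT: NOT
Bałaban's `G(U)` ∕ `C^{(k)}(Λ)(U)` with the background LIVE (NE2⁺ proper — NOT PRINTED beyond King's scalar template [King1986] Lemma 4.5 (4.38) p.674), NOT Node 00's [B9]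
operator layer of record (residual) — so **N15 is NOT discharged** (typed 28∕28 · discharged 5∕27 of record unchanged); one finite four-torus programme at fixed `ε` — NOT
ℝ⁴, NOT infinite volume, NOT OS, NOT a mass gap, NOT Clay.  Restate-immune (no Theses import).
-/

set_option autoImplicit false

noncomputable section
namespace Summit.QuantumFields.YangMills.BalabanUVNodes.N15.GenuineRecord

open Literature.MathematicalPhysics.QuantumFieldTheory.Balaban1983to89
open Literature.MathematicalPhysics.QuantumFieldTheory.Balaban1983to89.B11SectG (BlockNorm HasMaj)
open Literature.MathematicalPhysics.QuantumFieldTheory.Balaban1983to89.T4EtaRate (PairedInstance EtaPairing EtaRateIneq342 EtaRateIneqSite EtaRateIneqUnit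
  NE2PlusOperator NE2ZeroOperator NE2PlusSite NE2PlusUnit)
open Literature.MathematicalPhysics.QuantumFieldTheory.Balaban1983to89.T4EtaRateDefectSite (pt9Bg)
open Literature.MathematicalPhysics.QuantumFieldTheory.Balaban1983to89.B5Prop11Plancherel (Tor fine)
open Literature.MathematicalPhysics.QuantumFieldTheory.Balaban1983to89.B6UnitTorusCarrier (unitTorusGeo)
open Literature.MathematicalPhysics.QuantumFieldTheory.King1986.Torus (blockOf tdistT tdistT_nonneg)
open Summit.QuantumFields.YangMills.BalabanUVNodes.N15.TwoGrid (TGIndex tgInstance tgGeoC tgGeoF tgPairing tgFamily tgOps tgT1 tgT2 hasMaj_tgT1 hasMaj_tgT2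
  hasMaj_rescale etaRateIneq342_tg hasMaj_twoGridDefect hasMaj_twoGridDefect_lap)
open Summit.QuantumFields.YangMills.BalabanUVNodes.N15.GenuineSite (genuineSiteStep etaRateIneqSite_genuineSite_family)
open Summit.QuantumFields.YangMills.BalabanUVNodes.N15.VectorPiece (blkFine)
open YMDAG.UVSplit (NE2Carriers N15At)

variable {d : ℕ} {L : ℕ} [NeZero L]

/-! ## §1 The sized index: the L-divisible torus indices of record with Bałaban's size parameter `M` free -/

/-- INDEX OF THE SIZED GENUINE FAMILY: a torus index of record (part 55 `TGIndex`: torus exponent `m_T`, `k ≥ 1` scales, scale shift `m`) with `m_T ≥ 1` (periods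
`M_μ = 2L^{m_T}` divisible by `L`, where (2.156) exists — part 76's `TGIndexL`) together with Bałaban's SIZE PARAMETER `M ≥ 1` as a free real (the estimates at `U ≡ 1` are
uniform in it). [cite: Balaban1985BackgroundPropagators, Thm 3.1 p.397 («for M ≥ M₁»: the size parameter of the quantifier template); (3.35) p.396 (the `M`-cubes)] -/
structure TGIndexS extends TGIndex where
  /-- `m_T ≥ 1`: the torus is L-divisible -/
  one_le_mT : 1 ≤ mT
  /-- Bałaban's size parameter `M` ([B9] p.396: the large cubes have side `O(1)·M`) -/
  Msz : ℝ
  /-- `M ≥ 1` -/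
  one_le_Msz : 1 ≤ Msz

/-- The underlying L-divisible index. [folklore] -/
def TGIndexS.toL (j : TGIndexS) : TGIndexL := ⟨j.toTGIndex, j.one_le_mT⟩

/-- An L-divisible index read at a given size `M ≥ 1`. [folklore] -/
def TGIndexL.withSize (i : TGIndexL) {Msz : ℝ} (h : 1 ≤ Msz) : TGIndexS := ⟨i.1, i.2, Msz, h⟩

/-- `withSize` followed by `toL` is the identity. [folklore] -/
@[simp] theorem TGIndexL.toL_withSize (i : TGIndexL) {Msz : ℝ} (h : 1 ≤ Msz) : (i.withSize h).toL = i := rfl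

/-- `withSize` records the size. [folklore] -/
@[simp] theorem TGIndexL.Msz_withSize (i : TGIndexL) {Msz : ℝ} (h : 1 ≤ Msz) : (i.withSize h).Msz = Msz := rfl

/-- The underlying torus index of `withSize` is the given one. [folklore] -/
@[simp] theorem TGIndexL.toTGIndex_withSize (i : TGIndexL) {Msz : ℝ} (h : 1 ≤ Msz) : (i.withSize h).toTGIndex = i.1 := rfl

/-- NON-VACUITY: the sized index type carries `(m_T, k, m, M) = (1, 1, 0, 1)`. [folklore] -/
theorem tgIndexS_nonempty : Nonempty TGIndexS := ⟨⟨⟨1, 1, le_rfl, 0⟩, le_rfl, 1, le_rfl⟩⟩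

/-- ★ **THE SIZED FAMILY IS COFINAL IN THE SIZE AND IN THE NUMBER OF SCALES** (the shape of the K3⁷ v2 guard `PairedFamilyGuard.Live.cofinal`): for every `M₅` and `k₀`
there is an index with `M ≥ M₅` and `k ≥ k₀` — so a guard `M₅ ≤ M` excludes nothing uniformly (it is live, not void), and every coarse run length occurs. [folklore] -/
theorem tgIndexS_cofinal (M₅ : ℝ) (k₀ : ℕ) : ∃ j : TGIndexS, M₅ ≤ j.Msz ∧ k₀ ≤ j.k :=
  ⟨⟨⟨1, max k₀ 1, le_max_right _ _, 0⟩, le_rfl, max M₅ 1, le_max_right _ _⟩, le_max_left _ _, le_max_left _ _⟩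

/-! ## §2 The sized carriers, pairing, instances and the transported kernel families -/

/-- THE SIZED COARSE GEOMETRY: part 55's `tgGeoC` (n15-b's `opGeo` over the unit-torus carrier of the run `k`, real 1-forms blocked by King's unit blocks) with the [B9]
size field set to the index's `M`. [cite: Balaban1985BackgroundPropagators, (3.42) p.397 (typing template); (3.35) p.396 (the size parameter `M`)] -/
@[reducible] def tgGeoCS (d : ℕ) (hL : Odd L ∧ 1 < L) (j : TGIndexS) : B9.Geometry :=
  { tgGeoC d hL j.toTGIndex with M := j.Msz }

/-- THE SIZED FINE GEOMETRY: part 55's `tgGeoF` (run `k + m`) with the size field set to the index's `M`. [cite: Balaban1985BackgroundPropagators, (3.42) p.397 (typing template); (3.35) p.396 (the size parameter `M`)] -/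
@[reducible] def tgGeoFS (d : ℕ) (hL : Odd L ∧ 1 < L) (j : TGIndexS) : B9.Geometry :=
  { tgGeoF d hL j.toTGIndex with M := j.Msz }

/-- THE η-PAIRING of the sized geometries: part 55's `tgPairing` VERBATIM (scale shift `m`, identity on sites, King's pull-back of test 1-forms; the size fields agree by
construction). [cite: King1986, p.664 (convention before Prop. 3.8)] -/
def tgPairingS (d : ℕ) (hL : Odd L ∧ 1 < L) (j : TGIndexS) : EtaPairing (tgGeoCS d hL j) (tgGeoFS d hL j) pt9Bg pt9Bg where
  n := (tgPairing d hL j.toTGIndex).n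
  k_eq := (tgPairing d hL j.toTGIndex).k_eq
  L_eq := (tgPairing d hL j.toTGIndex).L_eq
  M_eq := rfl
  eta_eq := (tgPairing d hL j.toTGIndex).eta_eq
  ι := (tgPairing d hL j.toTGIndex).ι
  scale_ι := (tgPairing d hL j.toTGIndex).scale_ι
  dist_ι := (tgPairing d hL j.toTGIndex).dist_ι
  τ := (tgPairing d hL j.toTGIndex).τ
  suppIn_τ := (tgPairing d hL j.toTGIndex).suppIn_τ
  supNorm_τ := (tgPairing d hL j.toTGIndex).supNorm_τ
  avg := (tgPairing d hL j.toTGIndex).avg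
  avg_one := (tgPairing d hL j.toTGIndex).avg_one

/-- THE SIZED REALISED PAIRED-INSTANCE FAMILY of the torus family of record (sized coarse∕fine geometries, one-point backgrounds, the pairing above).
[cite: Balaban1985BackgroundPropagators, Thm 3.14 pp.426–427 (typing template)] -/
def tgInstanceS (d : ℕ) (hL : Odd L ∧ 1 < L) (j : TGIndexS) : PairedInstance :=
  ⟨tgGeoCS d hL j, tgGeoFS d hL j, pt9Bg, pt9Bg, tgPairingS d hL j⟩

/-- The fine geometry's size field IS the index's `M` (the guard `M₅ ≤ (pi j).gf.M` reads `M₅ ≤ j.Msz`). [folklore] -/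
theorem tgInstanceS_gf_M (hL : Odd L ∧ 1 < L) (j : TGIndexS) : (tgInstanceS d hL j).gf.M = j.Msz := rfl

/-- The coarse geometry's size field IS the index's `M`. [folklore] -/
theorem tgInstanceS_gc_M (hL : Odd L ∧ 1 < L) (j : TGIndexS) : (tgInstanceS d hL j).gc.M = j.Msz := rfl

/-- The coarse run's number of scales IS the index's `k`. [folklore] -/
theorem tgInstanceS_gc_k (hL : Odd L ∧ 1 < L) (j : TGIndexS) : (tgInstanceS d hL j).gc.k = j.k := rfl

/-- The trivial configuration of the (one-point) fine background carrier satisfies both regularity conditions for every letter (the «+» blocks are inert there — said).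
[cite: Balaban1985BackgroundPropagators, (3.35)–(3.36) p.396 (shape)] -/
theorem reg_one_tgInstanceS (hL : Odd L ∧ 1 < L) (j : TGIndexS) (c α₀ : ℝ) :
    (tgInstanceS d hL j).Bf.Reg335 c α₀ (tgInstanceS d hL j).Bf.one ∧ (tgInstanceS d hL j).Bf.Reg336 c α₀ (tgInstanceS d hL j).Bf.one :=
  ⟨trivial, trivial⟩

/-- Every sized coarse geometry has a site (the torus is inhabited). [folklore] -/
theorem exists_site_tgGeoCS (hL : Odd L ∧ 1 < L) (j : TGIndexS) : ∃ _y : (tgGeoCS d hL j).Site, True := ⟨fun _ => 0, trivial⟩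

/-- THE OPERATOR KERNEL FAMILY on the sized instances: part 72's honest four-entry family `tgFamily b (tgT1 b ν) (tgT2 b μ)` of Bałaban's pair `(Δ′_b⁻¹, Δ_b⁻¹)` VERBATIM
(same entries; the size field enters nowhere). [cite: Balaban1985BackgroundPropagators, (3.42) p.397 (the four sup entries: shape)] -/
def tgFamilyS (d : ℕ) (hL : Odd L ∧ 1 < L) (b : ℝ) (ν μ : Fin (d + 1)) (j : TGIndexS) : B9.KernelFamily (tgInstanceS d hL j).gc (tgInstanceS d hL j).Bf :=
  ⟨(tgFamily d hL b (tgT1 d hL b ν) (tgT2 d hL b μ) j.toTGIndex).e, (tgFamily d hL b (tgT1 d hL b ν) (tgT2 d hL b μ) j.toTGIndex).h1,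
    (tgFamily d hL b (tgT1 d hL b ν) (tgT2 d hL b μ) j.toTGIndex).e4, (tgFamily d hL b (tgT1 d hL b ν) (tgT2 d hL b μ) j.toTGIndex).h2,
    (tgFamily d hL b (tgT1 d hL b ν) (tgT2 d hL b μ) j.toTGIndex).l2, (tgFamily d hL b (tgT1 d hL b ν) (tgT2 d hL b μ) j.toTGIndex).glob⟩

/-- THE SITE KERNEL on the sized instances: dag-n15-c G1's genuine `U ≡ 1` η-difference `𝔇((Q′G′²Q′*)⁻¹)` at King's couplings VERBATIM. [cite: Balaban1985BackgroundPropagators, Thm 3.2 (3.48) p.398 (the kernel)] -/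
def genuineSiteStepS (d : ℕ) (hL : Odd L ∧ 1 < L) (aS : ℝ) (j : TGIndexS) : B9.SiteKernel (tgInstanceS d hL j).gc (tgInstanceS d hL j).Bf :=
  ⟨(genuineSiteStep d hL aS j.toTGIndex).ker⟩

/-- THE UNIT KERNEL on the sized instances: part 76's η-difference of [B6] (2.156) `C^{(k)}_Λ` at the unit bonds of directions `α, β` VERBATIM.
[cite: Balaban1984PropagatorsII, (2.156) p.250 (object); Balaban1985BackgroundPropagators, Thm 3.15 (3.187) p.432 (shape)] -/
def tgCovStepS (d : ℕ) (hL : Odd L ∧ 1 < L) (α β : Fin (d + 1)) (j : TGIndexS) : B9.SiteKernel (tgInstanceS d hL j).gc (tgInstanceS d hL j).Bf :=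
  ⟨(tgCovStep d hL α β j.toTGIndex).ker⟩

/-- The (3.42) inequality for the sized operator family at `j` IS the inequality for part 72's family at the underlying index. [folklore] -/
theorem etaRateIneq342_tgFamilyS_iff (hL : Odd L ∧ 1 < L) (b : ℝ) (ν μ : Fin (d + 1)) (j : TGIndexS) (B δ γ : ℝ) :
    EtaRateIneq342 (tgFamilyS d hL b ν μ j) B δ γ () ↔ EtaRateIneq342 (tgFamily d hL b (tgT1 d hL b ν) (tgT2 d hL b μ) j.toTGIndex) B δ γ () :=
  Iff.rfl

/-- The (3.48)-shaped inequality for the sized site kernel at `j` IS the inequality for G1's kernel at the underlying index. [folklore] -/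
theorem etaRateIneqSite_genuineSiteStepS_iff (hL : Odd L ∧ 1 < L) (aS : ℝ) (j : TGIndexS) (d' : ℕ) (p C δ γ : ℝ) (U : Unit) :
    EtaRateIneqSite d' p (genuineSiteStepS d hL aS j) C δ γ U ↔ EtaRateIneqSite d' p (genuineSiteStep d hL aS j.toTGIndex) C δ γ U :=
  Iff.rfl

/-- The (3.187)-shaped inequality for the sized unit kernel at `j` IS the inequality for part 76's kernel at the underlying index. [folklore] -/
theorem etaRateIneqUnit_tgCovStepS_iff (hL : Odd L ∧ 1 < L) (α β : Fin (d + 1)) (j : TGIndexS) (B₀ δ₀ θ : ℝ) (k : ℕ) (U : Unit) :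
    EtaRateIneqUnit (tgCovStepS d hL α β j) (fun _ => True) (tgGeoCS d hL j).dist B₀ δ₀ θ k U ↔
      EtaRateIneqUnit (tgCovStep d hL α β j.toTGIndex) (fun _ => True) (tgGeoC d hL j.toTGIndex).dist B₀ δ₀ θ k U :=
  Iff.rfl

/-! ## §3 The guard-free operator-layer content of the full-propagator family (parts 52∕54∕59∕71 re-assembled outside the by-name `∃ M₅`) -/

/-- ★ **THE GUARD-FREE (3.42) CONTENT FOR BAŁABAN's FULL LANDAU-GAUGE PAIR `(G′, G) = (Δ′_b⁻¹, Δ_b⁻¹)` AT `U ≡ 1`, EVERY INDEX OF THE TORUS FAMILY OF RECORD**: for odd `L ≥ 3`,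
`b > 0` and directions `ν, μ` there are `B, δ₀, γ₀ > 0` such that at EVERY index `(m_T, k, m)` the honest four-entry kernel family of part 72 satisfies `EtaRateIneq342 … B δ₀ γ₀`
— entries 0∕3 = parts 52∕54 (`hasMaj_twoGridDefect`, `hasMaj_twoGridDefect_lap` at `γ = ½`), entry 1 = part 59 (`hasMaj_tgT1`), entry 2 = part 71 (`hasMaj_tgT2`), read through part
55's `etaRateIneq342_tg`; `γ₀ = min(¼, 1∕16, 1∕(8(d+1)))`.  Parts 55∕60∕72 stated this only INSIDE `NE2ZeroOperator`'s `∃ M₅` (where the idle guard `gf.M = 1` hides it); here it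
is a theorem in its own right. [cite: Balaban1985BackgroundPropagators, Thm 3.1 (3.42) p.397 (shape); King1986, Prop. 3.9 (3.73) p.665 (η-rate shape)] -/
theorem etaRateIneq342_fullG_family (hLodd : Odd L) (hL2 : 2 ≤ L) (hL : Odd L ∧ 1 < L) {b : ℝ} (hb : 0 < b) (ν μ : Fin (d + 1)) :
    ∃ B δ₀ γ₀ : ℝ, 0 < B ∧ 0 < δ₀ ∧ 0 < γ₀ ∧ ∀ i : TGIndex, EtaRateIneq342 (tgFamily d hL b (tgT1 d hL b ν) (tgT2 d hL b μ) i) B δ₀ γ₀ () := by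
  obtain ⟨δ₀, C₀, hδ₀, hC₀, H0⟩ := hasMaj_twoGridDefect (d := d) hLodd hL2 hb (γ := 1 / 2) (by norm_num) (by norm_num)
  obtain ⟨δ₃, C₃, hδ₃, hC₃, H3⟩ := hasMaj_twoGridDefect_lap (d := d) hLodd hL2 hb (γ := 1 / 2) (by norm_num) (by norm_num)
  obtain ⟨δ₁, C₁, hδ₁, hC₁, H1⟩ := hasMaj_tgT1 (d := d) hLodd hL2 hL hb ν
  obtain ⟨δ₂, C₂, hδ₂, hC₂, H2⟩ := hasMaj_tgT2 (d := d) hLodd hL2 hL hb μ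
  have hL1 : (1 : ℝ) ≤ (L : ℝ) := by exact_mod_cast (show 1 ≤ L by omega)
  have hd8 : (0 : ℝ) < 1 / (8 * ((d : ℝ) + 1)) := by positivity
  refine ⟨max (max C₀ C₃) (max C₁ C₂), min (min δ₀ δ₃) (min δ₁ δ₂), min (1 / 4) (min (1 / 16) (1 / (8 * ((d : ℝ) + 1)))),
    lt_max_of_lt_left (lt_max_of_lt_left hC₀), lt_min (lt_min hδ₀ hδ₃) (lt_min hδ₁ hδ₂), lt_min (by norm_num) (lt_min (by norm_num) hd8), fun i => ?_⟩
  have hB : 0 ≤ max (max C₀ C₃) (max C₁ C₂) := hC₀.le.trans ((le_max_left _ _).trans (le_max_left _ _))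
  have hcast : ((L ^ i.k : ℕ) : ℝ) = (L : ℝ) ^ i.k := by push_cast; ring
  have hq : (-((1 : ℝ) / 2 / 2)) = -(1 / 4) := by norm_num
  -- entries 0 and 3 (parts 52∕54), with the majorant's cast `((L^k : ℕ) : ℝ) = (L : ℝ)^k` and exponent `−(½∕2) = −¼` normalised (the operator is left untouched)
  have e0 : HasMaj (BlockNorm.ofBlocks (unitTorusGeo L i.k (TGIndex.Mn d hL i)) (blkFine L i.k (TGIndex.Mn d hL i)))
      (BlockNorm.ofBlocks (unitTorusGeo L i.k (TGIndex.Mn d hL i))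
        (fun j : Tor (fine (L ^ i.m * L ^ i.k) (TGIndex.Mn d hL i)) × Fin (d + 1) => blockOf (L ^ i.m * L ^ i.k) (TGIndex.Mn d hL i) j.1))
      (tgOps d hL b (tgT1 d hL b ν) (tgT2 d hL b μ) i 0 ())
      (fun y y' => C₀ * ((L : ℝ) ^ i.k) ^ (-(1 / 4 : ℝ)) * Real.exp (-(δ₀ * tdistT (TGIndex.Mn d hL i) y y'))) :=
    (H0 i.mT i.k i.m i.one_le hL).mono fun y y' => by rw [hcast, hq]; exact le_rfl
  have e3 : HasMaj (BlockNorm.ofBlocks (unitTorusGeo L i.k (TGIndex.Mn d hL i)) (blkFine L i.k (TGIndex.Mn d hL i)))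
      (BlockNorm.ofBlocks (unitTorusGeo L i.k (TGIndex.Mn d hL i))
        (fun j : Tor (fine (L ^ i.m * L ^ i.k) (TGIndex.Mn d hL i)) × Fin (d + 1) => blockOf (L ^ i.m * L ^ i.k) (TGIndex.Mn d hL i) j.1))
      (tgOps d hL b (tgT1 d hL b ν) (tgT2 d hL b μ) i 3 ())
      (fun y y' => C₃ * ((L : ℝ) ^ i.k) ^ (-(1 / 4 : ℝ)) * Real.exp (-(δ₃ * tdistT (TGIndex.Mn d hL i) y y'))) :=
    (H3 i.mT i.k i.m i.one_le hL).mono fun y y' => by rw [hcast, hq]; exact le_rfl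
  refine etaRateIneq342_tg hL b (tgT1 d hL b ν) (tgT2 d hL b μ) i hB fun n => ?_
  fin_cases n
  · exact hasMaj_rescale hL1 hB ((le_max_left C₀ C₃).trans (le_max_left _ _)) (min_le_left _ _) ((min_le_left _ _).trans (min_le_left δ₀ δ₃)) e0
  · exact hasMaj_rescale hL1 hB ((le_max_left C₁ C₂).trans (le_max_right _ _)) ((min_le_right _ _).trans (min_le_left _ _))
      ((min_le_right _ _).trans (min_le_left δ₁ δ₂)) (H1 i)
  · exact hasMaj_rescale hL1 hB ((le_max_right C₁ C₂).trans (le_max_right _ _)) ((min_le_right _ _).trans (min_le_right _ _))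
      ((min_le_right _ _).trans (min_le_right δ₁ δ₂)) (H2 i)
  · exact hasMaj_rescale hL1 hB ((le_max_right C₀ C₃).trans (le_max_left _ _)) (min_le_left _ _) ((min_le_left _ _).trans (min_le_right δ₀ δ₃)) e3

/-! ## §4 The node's layer predicates BY NAME on the sized family — and their equivalence with the guard-free content (certificates of non-vacuity) -/

/-- ★★ **NE2⁰, OPERATOR LAYER, BY NAME, ON THE SIZED FAMILY** (guard `M₅ ≤ M` LIVE: `M₅ = 1` and the family is cofinal in `M`) for Bałaban's full pair `(Δ′_b⁻¹, Δ_b⁻¹)` at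
`U ≡ 1`, all four (3.42) entries honest. [cite: Balaban1985BackgroundPropagators, Thm 3.1 (3.42) p.397 (shape); King1986, Props. 3.8–3.9 (3.71)–(3.75) pp.664–665 (A = 0 model)] -/
theorem ne2ZeroOperator_fullG_sized (hLodd : Odd L) (hL2 : 2 ≤ L) (hL : Odd L ∧ 1 < L) {b : ℝ} (hb : 0 < b) (ν μ : Fin (d + 1)) :
    NE2ZeroOperator (tgInstanceS d hL) (tgFamilyS d hL b ν μ) := by
  obtain ⟨B, δ₀, γ₀, hB, hδ₀, hγ₀, H⟩ := etaRateIneq342_fullG_family (d := d) hLodd hL2 hL hb ν μ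
  exact ⟨1, δ₀, B, γ₀, one_pos, hδ₀, hB, hγ₀, fun j _ => (etaRateIneq342_tgFamilyS_iff hL b ν μ j B δ₀ γ₀).mpr (H j.toTGIndex)⟩

/-- ★★ **NE2⁺, OPERATOR LAYER — the node's FIRST CONJUNCT `T4EtaRate.NE2PlusOperator` BY NAME — ON THE SIZED FAMILY, SIZE GUARD LIVE** (`M₅ = a₀ = 1`; the «+» block —
(3.35)-regular backgrounds — is inert on the one-point carrier, the content is NE2⁰'s, said). [cite: Balaban1985BackgroundPropagators, Thm 3.1 p.397 (quantifier template)] -/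
theorem ne2PlusOperator_fullG_sized (hLodd : Odd L) (hL2 : 2 ≤ L) (hL : Odd L ∧ 1 < L) {b : ℝ} (hb : 0 < b) (c35 : ℝ) (ν μ : Fin (d + 1)) :
    NE2PlusOperator c35 (tgInstanceS d hL) (tgFamilyS d hL b ν μ) := by
  obtain ⟨B, δ₀, γ₀, hB, hδ₀, hγ₀, H⟩ := etaRateIneq342_fullG_family (d := d) hLodd hL2 hL hb ν μ
  exact ⟨1, δ₀, 1, B, γ₀, one_pos, hδ₀, one_pos, hB, hγ₀, fun j _ _ _ _ U _ => by
    cases U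
    exact (etaRateIneq342_tgFamilyS_iff hL b ν μ j B δ₀ γ₀).mpr (H j.toTGIndex)⟩

/-- ★★ **CERTIFICATE OF NON-VACUITY: `NE2PlusOperator c₃₅` BY NAME on the sized family ⟺ the guard-free (3.42) content at EVERY L-divisible torus index** ((⇒) read the
by-name statement at size `max M₅ 1` with `α₀ := a₀ ∕ max M₅ 1` and `U = 1`; (⇐) take `M₅ = a₀ = 1`).  On part 55's `tgInstance` (all `gf.M = 1`) the left side is provable
with `M₅ = 2` and NO estimate (dag-n15-w2's `ne2PlusOperator_tgInstance_comp`); here it is not. [cite: Balaban1985BackgroundPropagators, Thm 3.1 p.397 (quantifier template)] -/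
theorem ne2PlusOperator_fullG_sized_iff (hL : Odd L ∧ 1 < L) (b c35 : ℝ) (ν μ : Fin (d + 1)) :
    NE2PlusOperator c35 (tgInstanceS d hL) (tgFamilyS d hL b ν μ) ↔
      ∃ B δ₀ γ₀ : ℝ, 0 < B ∧ 0 < δ₀ ∧ 0 < γ₀ ∧ ∀ i : TGIndexL, EtaRateIneq342 (tgFamily d hL b (tgT1 d hL b ν) (tgT2 d hL b μ) i.1) B δ₀ γ₀ () := by
  constructor
  · rintro ⟨M₅, δ₀, a₀, B₀, γ, -, hδ₀, ha₀, hB₀, hγ, H⟩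
    refine ⟨B₀, δ₀, γ, hB₀, hδ₀, hγ, fun i => ?_⟩
    have hM : 0 < max M₅ 1 := lt_of_lt_of_le one_pos (le_max_right M₅ 1)
    have hguard : (tgInstanceS d hL (i.withSize (le_max_right M₅ 1))).gf.M * (a₀ / max M₅ 1) ≤ a₀ := by
      rw [tgInstanceS_gf_M]
      show max M₅ 1 * (a₀ / max M₅ 1) ≤ a₀
      rw [mul_div_cancel₀ a₀ hM.ne']
    exact (etaRateIneq342_tgFamilyS_iff hL b ν μ (i.withSize (le_max_right M₅ 1)) B₀ δ₀ γ).mp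
      (H (i.withSize (le_max_right M₅ 1)) (le_max_left M₅ 1) (a₀ / max M₅ 1) (div_pos ha₀ hM) hguard () trivial)
  · rintro ⟨B, δ₀, γ₀, hB, hδ₀, hγ₀, H⟩
    refine ⟨1, δ₀, 1, B, γ₀, one_pos, hδ₀, one_pos, hB, hγ₀, fun j _ α₀ _ _ U _ => ?_⟩
    cases U
    exact (etaRateIneq342_tgFamilyS_iff hL b ν μ j B δ₀ γ₀).mpr (H j.toL)

/-- The same certificate for `NE2ZeroOperator` ((⇒) read at size `max M₅ 1`; (⇐) `M₅ = 1`). [cite: King1986, Props. 3.8–3.9 (3.71)–(3.75) pp.664–665 (A = 0 model, shape)] -/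
theorem ne2ZeroOperator_fullG_sized_iff (hL : Odd L ∧ 1 < L) (b : ℝ) (ν μ : Fin (d + 1)) :
    NE2ZeroOperator (tgInstanceS d hL) (tgFamilyS d hL b ν μ) ↔
      ∃ B δ₀ γ₀ : ℝ, 0 < B ∧ 0 < δ₀ ∧ 0 < γ₀ ∧ ∀ i : TGIndexL, EtaRateIneq342 (tgFamily d hL b (tgT1 d hL b ν) (tgT2 d hL b μ) i.1) B δ₀ γ₀ () := by
  constructor
  · rintro ⟨M₅, δ₀, B₀, γ, -, hδ₀, hB₀, hγ, H⟩
    exact ⟨B₀, δ₀, γ, hB₀, hδ₀, hγ, fun i =>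
      (etaRateIneq342_tgFamilyS_iff hL b ν μ (i.withSize (le_max_right M₅ 1)) B₀ δ₀ γ).mp (H (i.withSize (le_max_right M₅ 1)) (le_max_left M₅ 1))⟩
  · rintro ⟨B, δ₀, γ₀, hB, hδ₀, hγ₀, H⟩
    exact ⟨1, δ₀, B, γ₀, one_pos, hδ₀, hB, hγ₀, fun j _ => (etaRateIneq342_tgFamilyS_iff hL b ν μ j B δ₀ γ₀).mpr (H j.toL)⟩

/-- ★★ **NE2⁺, SITE-KERNEL LAYER — the node's SECOND CONJUNCT `T4EtaRate.NE2PlusSite` BY NAME — ON THE SIZED FAMILY, SIZE GUARD LIVE**, for dag-n15-c G1's genuine `U ≡ 1`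
kernel `𝔇((Q′G′²Q′*)⁻¹)` at King's couplings, every `(d′, p)` and `c₃₅`: constants `(M₅, δ, a₀, C, γ) = (1, δ, 1, C, ¼)`; odd `L ≥ 3`, `a_S > 0`.
[cite: Balaban1985BackgroundPropagators, Thm 3.2 (3.48) p.398 + Thm 3.14 pp.426–427 (quantifier template)] -/
theorem ne2PlusSite_genuineSite_sized (hLodd : Odd L) (hL2 : 2 ≤ L) (hL : Odd L ∧ 1 < L) {aS : ℝ} (haS : 0 < aS) (d' : ℕ) (p c35 : ℝ) :
    NE2PlusSite d' p c35 (tgInstanceS d hL) (genuineSiteStepS d hL aS) := by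
  obtain ⟨δ, C, hδ, hC, H⟩ := etaRateIneqSite_genuineSite_family (d := d) hLodd hL2 hL haS d' p
  exact ⟨1, δ, 1, C, 1 / 4, one_pos, hδ, one_pos, hC, by norm_num, fun j _ _ _ _ U _ =>
    (etaRateIneqSite_genuineSiteStepS_iff hL aS j d' p C δ (1 / 4) U).mpr (H j.toTGIndex U)⟩

/-- ★★ **CERTIFICATE OF NON-VACUITY for the site layer: `NE2PlusSite d′ p c₃₅` BY NAME on the sized family ⟺ the guard-free (3.48)-shaped content at every L-divisible
torus index** ((⇒) read at size `max M₅ 1`, `α₀ := a₀ ∕ max M₅ 1`; (⇐) `M₅ = a₀ = 1`). [cite: Balaban1985BackgroundPropagators, Thm 3.2 (3.48) p.398 (quantifier template)] -/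
theorem ne2PlusSite_genuineSite_sized_iff (hL : Odd L ∧ 1 < L) (aS : ℝ) (d' : ℕ) (p c35 : ℝ) :
    NE2PlusSite d' p c35 (tgInstanceS d hL) (genuineSiteStepS d hL aS) ↔
      ∃ δ C γ : ℝ, 0 < δ ∧ 0 < C ∧ 0 < γ ∧ ∀ (i : TGIndexL) (U : Unit), EtaRateIneqSite d' p (genuineSiteStep d hL aS i.1) C δ γ U := by
  constructor
  · rintro ⟨M₅, δ, a₀, C, γ, -, hδ, ha₀, hC, hγ, H⟩
    refine ⟨δ, C, γ, hδ, hC, hγ, fun i U => ?_⟩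
    have hM : 0 < max M₅ 1 := lt_of_lt_of_le one_pos (le_max_right M₅ 1)
    have hguard : (tgInstanceS d hL (i.withSize (le_max_right M₅ 1))).gf.M * (a₀ / max M₅ 1) ≤ a₀ := by
      rw [tgInstanceS_gf_M]
      show max M₅ 1 * (a₀ / max M₅ 1) ≤ a₀
      rw [mul_div_cancel₀ a₀ hM.ne']
    cases U
    exact (etaRateIneqSite_genuineSiteStepS_iff hL aS (i.withSize (le_max_right M₅ 1)) d' p C δ γ ()).mp
      (H (i.withSize (le_max_right M₅ 1)) (le_max_left M₅ 1) (a₀ / max M₅ 1) (div_pos ha₀ hM) hguard () trivial)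
  · rintro ⟨δ, C, γ, hδ, hC, hγ, H⟩
    exact ⟨1, δ, 1, C, γ, one_pos, hδ, one_pos, hC, hγ, fun j _ _ _ _ U _ =>
      (etaRateIneqSite_genuineSiteStepS_iff hL aS j d' p C δ γ U).mpr (H j.toL U)⟩

/-- ★★ **NE2⁺, UNIT-LATTICE LAYER — the node's THIRD CONJUNCT `T4EtaRate.NE2PlusUnit` BY NAME — ON THE SIZED FAMILY** for Bałaban's own [B6] (2.156) covariance `C^{(k)}_Λ`
at `U ≡ 1`, every direction pair and `c₃₅`: constants `(δ₀, a₀, B₀, θ) = (δ₀, 1, B₀, L⁻¹)`, clean rate `θ = L⁻¹ < 1`, NO weight window, NO Neumann series; the unit layer has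
no size threshold — its guard `M·α₀ ≤ a₀` is read in the honest direction and is void at `U ≡ 1` (the (2.156) content is `M`-free), `d ≥ 1`, `L ≥ 2`.
[cite: Balaban1985BackgroundPropagators, Thm 3.15 (3.187) p.432 (quantifier template); King1986, Lemma 4.5 (4.38) p.674 (shape)] -/
theorem ne2PlusUnit_tgCov_sized (hd : 1 ≤ d) (hL2 : 2 ≤ L) (hL : Odd L ∧ 1 < L) (α β : Fin (d + 1)) (c35 : ℝ) :
    NE2PlusUnit c35 (tgInstanceS d hL) (tgCovStepS d hL α β) (fun _ _ => True) (fun j => (tgGeoCS d hL j).dist) := by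
  obtain ⟨B₀, δ₀, hB₀, hδ₀, H⟩ := etaRateIneqUnit_tgCov (d := d) hd hL
  have hLpos : (0 : ℝ) < L := by exact_mod_cast (lt_of_lt_of_le zero_lt_two hL2)
  have hθ1 : ((L : ℝ)⁻¹) < 1 := inv_lt_one_of_one_lt₀ (by exact_mod_cast hL2)
  exact ⟨δ₀, 1, B₀, (L : ℝ)⁻¹, hδ₀, one_pos, hB₀, inv_pos.mpr hLpos, hθ1, fun j _ _ _ U _ _ =>
    (etaRateIneqUnit_tgCovStepS_iff hL α β j B₀ δ₀ ((L : ℝ)⁻¹) j.k U).mpr (H α β j.toL U)⟩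

/-- ★★ **CERTIFICATE for the unit layer: `NE2PlusUnit c₃₅` BY NAME on the sized family ⟺ the guard-free (3.187)-shaped content with a clean rate `θ ∈ (0,1)` at every
L-divisible torus index** ((⇒) read at size `1` with `α₀ := a₀`; (⇐) `a₀ = 1`). [cite: Balaban1985BackgroundPropagators, Thm 3.15 (3.187) p.432 (quantifier template)] -/
theorem ne2PlusUnit_tgCov_sized_iff (hL : Odd L ∧ 1 < L) (α β : Fin (d + 1)) (c35 : ℝ) :
    NE2PlusUnit c35 (tgInstanceS d hL) (tgCovStepS d hL α β) (fun _ _ => True) (fun j => (tgGeoCS d hL j).dist) ↔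
      ∃ δ₀ B₀ θ : ℝ, 0 < δ₀ ∧ 0 < B₀ ∧ 0 < θ ∧ θ < 1 ∧
        ∀ (i : TGIndexL) (U : Unit), EtaRateIneqUnit (tgCovStep d hL α β i.1) (fun _ => True) (tgGeoC d hL i.1).dist B₀ δ₀ θ i.1.k U := by
  constructor
  · rintro ⟨δ₀, a₀, B₀, θ, hδ₀, ha₀, hB₀, hθ, hθ1, H⟩
    refine ⟨δ₀, B₀, θ, hδ₀, hB₀, hθ, hθ1, fun i U => ?_⟩
    have hguard : (tgInstanceS d hL (i.withSize le_rfl)).gf.M * a₀ ≤ a₀ := by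
      rw [tgInstanceS_gf_M]
      show (1 : ℝ) * a₀ ≤ a₀
      rw [one_mul]
    cases U
    exact (etaRateIneqUnit_tgCovStepS_iff hL α β (i.withSize le_rfl) B₀ δ₀ θ i.1.k ()).mp (H (i.withSize le_rfl) a₀ ha₀ hguard () trivial trivial)
  · rintro ⟨δ₀, B₀, θ, hδ₀, hB₀, hθ, hθ1, H⟩
    exact ⟨δ₀, 1, B₀, θ, hδ₀, one_pos, hB₀, hθ, hθ1, fun j _ _ _ U _ _ =>
      (etaRateIneqUnit_tgCovStepS_iff hL α β j B₀ δ₀ θ j.k U).mpr (H j.toL U)⟩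

/-! ## §5 `N15At` — all three conjuncts BY NAME — on the sized (guard-live) genuine family, outright -/

/-- ★★★ **`N15At` — ALL THREE NE2 CONJUNCTS BY NAME, NO DISPLAYED BINDER, NO WEIGHT WINDOW, SIZE GUARD LIVE — FOR BAŁABAN's GENUINE `U ≡ 1` OBJECTS ON THE SIZED
L-DIVISIBLE TORUS FAMILY OF RECORD** (cofinal in `gf.M` AND `gc.k`).  For `d ≥ 1`, odd `L ≥ 3`, couplings `b, a_S > 0`, directions `ν, μ` (entry 1's gradient ∕ entry 2's
divergence) and `α, β` (the unit bonds' directions), EVERY `c₃₅` and `p`: `N15At ⟨TGIndexS, c₃₅, p, tgInstanceS, tgFamilyS b ν μ, genuineSiteStepS a_S, tgCovStepS α β, ⊤, dist⟩` —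
OPERATOR = §4 `ne2PlusOperator_fullG_sized` (all four (3.42) entries of `(Δ′_b⁻¹, Δ_b⁻¹)`), SITE = `ne2PlusSite_genuineSite_sized` (`(Q′G′²Q′*)⁻¹`), UNIT = `ne2PlusUnit_tgCov_sized`
([B6] (2.156)).  One-point background carrier: the «+» blocks are inert (content NE2⁰'s) — said; the statement is NOT satisfiable by an idle guard (§4 certificates). [bookkeeping] -/
theorem n15At_fullG_sized (hd : 1 ≤ d) (hLodd : Odd L) (hL2 : 2 ≤ L) (hL : Odd L ∧ 1 < L) {b aS : ℝ} (hb : 0 < b) (haS : 0 < aS)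
    (ν μ α β : Fin (d + 1)) (c35 p : ℝ) :
    N15At { I := TGIndexS, c35 := c35, p := p, pi := tgInstanceS d hL, Kop := tgFamilyS d hL b ν μ, Ksite := genuineSiteStepS d hL aS,
            Kunit := tgCovStepS d hL α β, inΛ := fun _ _ => True, unitDist := fun j => (tgGeoCS d hL j).dist } :=
  ⟨ne2PlusOperator_fullG_sized (d := d) hLodd hL2 hL hb c35 ν μ,
   ne2PlusSite_genuineSite_sized (d := d) hLodd hL2 hL haS 4 p c35,
   ne2PlusUnit_tgCov_sized (d := d) hd hL2 hL α β c35⟩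

/-- **THE THREE LAYERS SPELLED OUT** (`N15At` unfolded) on the sized family. [bookkeeping] -/
theorem layers_fullG_sized (hd : 1 ≤ d) (hLodd : Odd L) (hL2 : 2 ≤ L) (hL : Odd L ∧ 1 < L) {b aS : ℝ} (hb : 0 < b) (haS : 0 < aS)
    (ν μ α β : Fin (d + 1)) (c35 p : ℝ) :
    NE2PlusOperator c35 (tgInstanceS d hL) (tgFamilyS d hL b ν μ) ∧ NE2PlusSite 4 p c35 (tgInstanceS d hL) (genuineSiteStepS d hL aS) ∧
      NE2PlusUnit c35 (tgInstanceS d hL) (tgCovStepS d hL α β) (fun _ _ => True) (fun j => (tgGeoCS d hL j).dist) :=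
  n15At_fullG_sized (d := d) hd hLodd hL2 hL hb haS ν μ α β c35 p

/-- The four-dimensional instance (`d + 1 = 4`). [bookkeeping] -/
theorem n15At_fullG_sized_dim4 (hLodd : Odd L) (hL2 : 2 ≤ L) (hL : Odd L ∧ 1 < L) {b aS : ℝ} (hb : 0 < b) (haS : 0 < aS) (ν μ α β : Fin 4) (c35 p : ℝ) :
    N15At { I := TGIndexS, c35 := c35, p := p, pi := tgInstanceS 3 hL, Kop := tgFamilyS 3 hL b ν μ, Ksite := genuineSiteStepS 3 hL aS,
            Kunit := tgCovStepS 3 hL α β, inΛ := fun _ _ => True, unitDist := fun j => (tgGeoCS 3 hL j).dist } :=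
  n15At_fullG_sized (d := 3) (by norm_num) hLodd hL2 hL hb haS ν μ α β c35 p

end Summit.QuantumFields.YangMills.BalabanUVNodes.N15.GenuineRecord

end
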